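import Mathlib
import Literature.GroupTheory.CombinatorialGroupTheory.NielsenCancellation
import Literature.GroupTheory.CombinatorialGroupTheory.NielsenTheorem
import Literature.Topology.FourManifolds.PlanarShadowWalk
import HarnessLib

/-!
# Junctions of core letters in `F₂`: swallowing, the four cases, and survival of cores

Topic `Literature/Topology/FourManifolds`, companion of `PlanarShadowWalk.lean`
(`Literature.Topology.FourManifolds.PlanarShadow`), built on the cancellation calculus of
`Literature/GroupTheory/CombinatorialGroupTheory/NielsenCancellation.lean` (`maxCancel`,
`toWord_mul_eq`, locality lemmas) and `NielsenTheorem.lean` (`take_eq_invRev_drop`).  Pure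
combinatorial group theory, fully proved, no definitions.  This is the word-level half of the
peak-reduction proof (`PlanarShadowDouble.lean`) that every four-letter shadow state of core
letters with trivial product walks to an honest double — the lever `stub_shadowWalkK4` of the
line `Sketch` of crux `ConvexBisection.PlanarAcyclicBisectionRigidity` (stmt-SmoothPoincare4-15086).

A CORE LETTER is a conjugate of `mk [g]`, `g` a generator or an inverse generator of
`F₂ = FreeGroup (Fin 2)`; its reduced word is `A ++ [g] ++ A⁻¹` (`exists_toWord_eq_of_isConj`,
§1: strip from the conjugator the trailing letters on the generator of `g`, which commute past the
core).  At a junction `(ℓ, ℓ′)` of core letters, `ℓ = A g A⁻¹`, `ℓ′ = B h B⁻¹`, with `k` the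
maximal cancellation of the reduced words, exactly one of four things happens (`junction_cases`,
§3): (J1) `k ≤ |A|, |B|` — both cores survive; (J2) `|A| < |B|`, `k > |A|` — then `B` begins
with `A g⁻¹` ("`ℓ′` swallows the core of `ℓ`", `take_eq_of_maxCancel_ge`) and
`‖ℓ ℓ′ ℓ⁻¹‖ + 2 ≤ ‖ℓ′‖` (`norm_conj_add_two_le`): the Hurwitz move shortens; (J3) the mirror
image `‖ℓ′⁻¹ ℓ ℓ′‖ + 2 ≤ ‖ℓ‖` (`norm_conj_inv_add_two_le`, reduced to (J2) by the symmetry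
`maxCancel (Y⁻¹) (X⁻¹) = maxCancel X Y`, `maxCancel_invRev`); (J4) `|A| = |B|`, `k > |A|` — then
`ℓ′ = ℓ⁻¹` (`eq_inv_of_maxCancel`).  If the three junctions of `ℓ₀ℓ₁ℓ₂ℓ₃` are all (J1), the
reduced word of the product still ends with the second half `g₃ A₃⁻¹` of the last letter
(`toWord_mul_suffix`, by locality of the cancellation), so the product is not `1`
(`prod_ne_one_of_J1`).  Sources for the method: Lyndon–Schupp, *Combinatorial Group Theory*,
Ch. I §2 (cancellation between reduced words); E. Artin, *Theory of braids*, Ann. of Math. 48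
(1947), §§7–9 (peak reduction for tuples of conjugates of generators).
-/

namespace Literature.Topology.FourManifolds.PlanarShadow

open FreeGroup Literature.GroupTheory.CombinatorialGroupTheory


/-! ## §1 Core letters and their reduced words -/

/-- `mk [(g.1, !g.2)]` is the inverse of `mk [g]`. [folklore] -/
theorem mk_flip_eq_inv (g : Fin 2 × Bool) :
    (FreeGroup.mk [(g.1, !g.2)] : F₂) = (FreeGroup.mk [g])⁻¹ := by
  rw [FreeGroup.inv_mk]; rfl

/-- `invRev` of a singleton. [folklore] -/
theorem invRev_singleton (g : Fin 2 × Bool) : invRev [g] = [(g.1, !g.2)] := by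
  simp [FreeGroup.invRev]

/-- Letters on the same generator commute past a core: `l g l⁻¹ = g` when `l.1 = g.1`. [folklore] -/
theorem mk_conj_mk_eq_of_fst_eq {l g : Fin 2 × Bool} (h : l.1 = g.1) :
    (FreeGroup.mk [l] : F₂) * FreeGroup.mk [g] * (FreeGroup.mk [l])⁻¹ = FreeGroup.mk [g] := by
  obtain ⟨i, b⟩ := l
  obtain ⟨j, c⟩ := g
  simp only at h
  subst h
  have key : ∀ d : Bool, (FreeGroup.mk [(i, d)] : F₂) = (FreeGroup.of i) ^ (if d then (1 : ℤ) else -1) := by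
    intro d
    cases d
    · simp [FreeGroup.of, FreeGroup.inv_mk, FreeGroup.invRev]
    · simp [FreeGroup.of]
  rw [key b, key c, ← zpow_neg, ← zpow_add, ← zpow_add]
  congr 1
  ring

/-- The reduced word of a CORE LETTER (a conjugate of `mk [g]`, `g` a generator or an inverse
generator) has the form `A ++ [g] ++ A⁻¹` (auxiliary form, by induction on the conjugator).
[folklore] -/
theorem exists_toWord_eq_aux (g : Fin 2 × Bool) :
    ∀ (n : ℕ) (c : F₂), c.toWord.length = n →
      ∃ A : List (Fin 2 × Bool), (c * FreeGroup.mk [g] * c⁻¹).toWord = A ++ [g] ++ invRev A := by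
  intro n
  induction n using Nat.strong_induction_on with
  | _ n ih =>
    intro c hc
    rcases List.eq_nil_or_concat c.toWord with h0 | ⟨C, l, hC⟩
    · refine ⟨[], ?_⟩
      have : c = 1 := FreeGroup.toWord_eq_nil_iff.1 h0
      subst this
      simp [FreeGroup.toWord_mk, FreeGroup.invRev]
    · rw [List.concat_eq_append] at hC
      have hcC : c = FreeGroup.mk C * FreeGroup.mk [l] := by
        rw [FreeGroup.mul_mk, ← hC, FreeGroup.mk_toWord]
      have hred : IsReduced (C ++ [l]) := by rw [← hC]; exact FreeGroup.isReduced_toWord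
      have hCred : IsReduced C := hred.infix ⟨[], [l], by simp⟩
      have hCw : (FreeGroup.mk C).toWord = C := by rw [FreeGroup.toWord_mk, hCred.reduce_eq]
      by_cases hl : l.1 = g.1
      · -- the last letter of the conjugator commutes past the core: induction
        have hlen : (FreeGroup.mk C).toWord.length < n := by
          rw [hCw, ← hc, hC]; simp
        obtain ⟨A, hA⟩ := ih _ hlen (FreeGroup.mk C) rfl
        refine ⟨A, ?_⟩
        rw [← hA, hcC]
        congr 1
        have : FreeGroup.mk C * FreeGroup.mk [l] * FreeGroup.mk [g] * (FreeGroup.mk C * FreeGroup.mk [l])⁻¹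
            = FreeGroup.mk C * (FreeGroup.mk [l] * FreeGroup.mk [g] * (FreeGroup.mk [l])⁻¹) *
              (FreeGroup.mk C)⁻¹ := by group
        rw [this, mk_conj_mk_eq_of_fst_eq hl]
      · -- the word `C l g l⁻¹ C⁻¹` is reduced
        refine ⟨C ++ [l], ?_⟩
        have hw : c * FreeGroup.mk [g] * c⁻¹ =
            FreeGroup.mk ((C ++ [l]) ++ [g] ++ invRev (C ++ [l])) := by
          rw [hcC, FreeGroup.mul_mk, FreeGroup.mul_mk, FreeGroup.inv_mk, FreeGroup.mul_mk]
        rw [hw, FreeGroup.toWord_mk]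
        apply IsReduced.reduce_eq
        have hinv : IsReduced (invRev (C ++ [l])) := by
          apply IsReduced.of_reduce_eq
          rw [FreeGroup.reduce_invRev, hred.reduce_eq]
        have e : invRev (C ++ [l]) = (l.1, !l.2) :: invRev C := by simp [FreeGroup.invRev]
        rw [e] at hinv ⊢
        rw [List.append_assoc, List.singleton_append]
        refine List.IsChain.append hred (List.isChain_cons_cons.2 ⟨fun hgl => absurd hgl.symm hl, hinv⟩) ?_
        intro x hx y hy
        simp only [List.getLast?_append, List.getLast?_singleton, Option.some_or, Option.mem_def,
          Option.some.injEq, List.head?_cons] at hx hy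
        subst hx; subst hy
        intro hlg
        exact absurd hlg hl

/-- **The reduced word of a core letter**: a conjugate of `mk [g]` has reduced word
`A ++ [g] ++ A⁻¹` for some `A`. [folklore] -/
theorem exists_toWord_eq_of_isConj {g : Fin 2 × Bool} {ℓ : F₂} (h : IsConj (FreeGroup.mk [g]) ℓ) :
    ∃ A : List (Fin 2 × Bool), ℓ.toWord = A ++ [g] ++ invRev A := by
  obtain ⟨c, hc⟩ := isConj_iff.1 h
  obtain ⟨A, hA⟩ := exists_toWord_eq_aux g _ c rfl
  exact ⟨A, by rw [← hc, hA]⟩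

/-- A core letter with word `A g A⁻¹` IS `mk A · mk [g] · (mk A)⁻¹`. [folklore] -/
theorem eq_conj_of_toWord {g : Fin 2 × Bool} {ℓ : F₂} {A : List (Fin 2 × Bool)}
    (h : ℓ.toWord = A ++ [g] ++ invRev A) :
    ℓ = FreeGroup.mk A * FreeGroup.mk [g] * (FreeGroup.mk A)⁻¹ := by
  rw [← FreeGroup.mk_toWord (x := ℓ), h, FreeGroup.inv_mk, FreeGroup.mul_mk, FreeGroup.mul_mk]

/-- The length of a core letter with word `A g A⁻¹` is `2|A| + 1`. [folklore] -/
theorem norm_of_toWord {g : Fin 2 × Bool} {ℓ : F₂} {A : List (Fin 2 × Bool)}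
    (h : ℓ.toWord = A ++ [g] ++ invRev A) : ℓ.norm = 2 * A.length + 1 := by
  rw [FreeGroup.norm, h]; simp [FreeGroup.invRev_length]; omega

/-- The inverse of a core letter with word `A g A⁻¹` has word `A g⁻¹ A⁻¹`. [folklore] -/
theorem toWord_inv_of_toWord {g : Fin 2 × Bool} {ℓ : F₂} {A : List (Fin 2 × Bool)}
    (h : ℓ.toWord = A ++ [g] ++ invRev A) : ℓ⁻¹.toWord = A ++ [(g.1, !g.2)] ++ invRev A := by
  rw [FreeGroup.toWord_inv, h, FreeGroup.invRev_append, FreeGroup.invRev_append, FreeGroup.invRev_invRev,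
    invRev_singleton, List.append_assoc]

/-! ## §2 One junction: the four cases -/

/-- **Swallowing**: if at least `|A| + 1` letters cancel between the core letter `ℓ = A g A⁻¹` and
`y`, then `y` begins with `A g⁻¹`. [folklore] -/
theorem take_eq_of_maxCancel_ge {g : Fin 2 × Bool} {ℓ y : F₂} {A : List (Fin 2 × Bool)}
    (h : ℓ.toWord = A ++ [g] ++ invRev A) (hk : A.length + 1 ≤ maxCancel ℓ.toWord y.toWord) :
    y.toWord.take (A.length + 1) = A ++ [(g.1, !g.2)] := by
  set k := maxCancel ℓ.toWord y.toWord with hkdef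
  have hkY : k ≤ y.toWord.length := maxCancel_le_length_right _ _
  have hkX : k ≤ ℓ.toWord.length := maxCancel_le_length_left _ _
  have hlen : ℓ.toWord.length = 2 * A.length + 1 := by rw [h]; simp [FreeGroup.invRev_length]; omega
  have key := take_eq_invRev_drop ℓ.toWord y.toWord
  rw [← hkdef] at key
  -- take the first `|A| + 1` letters of both sides
  have e1 : y.toWord.take (A.length + 1) = (y.toWord.take k).take (A.length + 1) := by
    rw [List.take_take, Nat.min_eq_left hk]
  rw [e1, key]
  -- `invRev` of a drop, truncated
  have e2 : (invRev (ℓ.toWord.drop (ℓ.toWord.length - k))).take (A.length + 1) =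
      invRev (ℓ.toWord.drop A.length) := by
    simp only [FreeGroup.invRev, List.map_drop, List.take_reverse, List.length_drop, List.length_map,
      List.drop_drop]
    congr 2
    omega
  rw [e2, h, List.append_assoc, List.drop_left, FreeGroup.invRev_append, FreeGroup.invRev_invRev,
    invRev_singleton]

/-- **(J2) the swallowing neighbour loses two letters under the Hurwitz move**: if
`ℓ = A g A⁻¹`, `ℓ′ = B h B⁻¹` with `|A| < |B|` and more than `|A|` letters cancel in `ℓ ℓ′`, then
`‖ℓ ℓ′ ℓ⁻¹‖ + 2 ≤ ‖ℓ′‖`. [folklore] -/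
theorem norm_conj_add_two_le {g h : Fin 2 × Bool} {ℓ ℓ' : F₂} {A B : List (Fin 2 × Bool)}
    (hA : ℓ.toWord = A ++ [g] ++ invRev A) (hB : ℓ'.toWord = B ++ [h] ++ invRev B)
    (hab : A.length < B.length) (hk : A.length + 1 ≤ maxCancel ℓ.toWord ℓ'.toWord) :
    (ℓ * ℓ' * ℓ⁻¹).norm + 2 ≤ ℓ'.norm := by
  have htake := take_eq_of_maxCancel_ge hA hk
  -- so `B = A ++ [g⁻¹] ++ B''`
  have hBsplit : B = (A ++ [(g.1, !g.2)]) ++ B.drop (A.length + 1) := by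
    have : B.take (A.length + 1) = A ++ [(g.1, !g.2)] := by
      rw [← htake, hB, List.append_assoc, List.take_append_of_le_length (by omega)]
    rw [← this, List.take_append_drop]
  set B'' := B.drop (A.length + 1) with hB''
  have hB''len : B''.length = B.length - (A.length + 1) := by rw [hB'', List.length_drop]
  -- group computation
  have hℓ := eq_conj_of_toWord hA
  have hℓ' := eq_conj_of_toWord hB
  have hmkB : FreeGroup.mk B = FreeGroup.mk A * (FreeGroup.mk [g])⁻¹ * FreeGroup.mk B'' := by
    rw [hBsplit, ← FreeGroup.mul_mk, ← FreeGroup.mul_mk, mk_flip_eq_inv]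
  have hconj : ℓ * ℓ' * ℓ⁻¹ =
      FreeGroup.mk A * FreeGroup.mk B'' * FreeGroup.mk [h] * (FreeGroup.mk B'')⁻¹ * (FreeGroup.mk A)⁻¹ := by
    rw [hℓ, hℓ', hmkB]; group
  have hconj' : ℓ * ℓ' * ℓ⁻¹ = FreeGroup.mk (A ++ B'' ++ [h] ++ invRev B'' ++ invRev A) := by
    rw [hconj]; simp only [FreeGroup.inv_mk, FreeGroup.mul_mk]
  rw [hconj', norm_of_toWord hB]
  have := FreeGroup.norm_mk_le (L₁ := A ++ B'' ++ [h] ++ invRev B'' ++ invRev A)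
  simp only [List.length_append, List.length_singleton, FreeGroup.invRev_length] at this
  omega

/-- The maximal cancellation is symmetric under inverting and exchanging the two words:
`maxCancel (Y⁻¹) (X⁻¹) = maxCancel X Y` (the cancellation in `y⁻¹ x⁻¹ = (x y)⁻¹` mirrors that in
`x y`). [folklore] -/
theorem maxCancel_invRev (X Y : List (Fin 2 × Bool)) : maxCancel (invRev Y) (invRev X) = maxCancel X Y := by
  -- `cancelAux` is symmetric and invariant under flipping all signs
  have hsymm : ∀ R L : List (Fin 2 × Bool), cancelAux R L = cancelAux L R := by
    intro R
    induction R with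
    | nil => intro L; cases L <;> simp
    | cons a r ih =>
      intro L
      cases L with
      | nil => simp
      | cons b s =>
        rw [cancelAux_cons_cons, cancelAux_cons_cons, ih s]
        by_cases hab : Cancels a b
        · rw [if_pos hab, if_pos hab.symm]
        · rw [if_neg hab, if_neg (fun h' => hab h'.symm)]
  have hmap : ∀ R L : List (Fin 2 × Bool),
      cancelAux (R.map fun x => (x.1, !x.2)) (L.map fun x => (x.1, !x.2)) = cancelAux R L := by
    intro R
    induction R with
    | nil => intro L; cases L <;> simp
    | cons a r ih =>
      intro L
      cases L with
      | nil => simp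
      | cons b s =>
        rw [List.map_cons, List.map_cons, cancelAux_cons_cons, cancelAux_cons_cons, ih s]
        have : Cancels (a.1, !a.2) (b.1, !b.2) ↔ Cancels a b := by
          obtain ⟨a1, a2⟩ := a
          obtain ⟨b1, b2⟩ := b
          cases a2 <;> cases b2 <;> simp [Cancels]
        by_cases hab : Cancels a b
        · rw [if_pos hab, if_pos (this.2 hab)]
        · rw [if_neg hab, if_neg (fun h' => hab (this.1 h'))]
  rw [maxCancel, maxCancel]
  simp only [FreeGroup.invRev, List.reverse_reverse, ← List.map_reverse]
  rw [hmap, hsymm]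

/-- **(J3) the mirror image of (J2)**: if `ℓ = A g A⁻¹`, `ℓ′ = B h B⁻¹` with `|B| < |A|` and more
than `|B|` letters cancel in `ℓ ℓ′`, then the inverse Hurwitz move lowers the length:
`‖ℓ′⁻¹ ℓ ℓ′‖ + 2 ≤ ‖ℓ‖`. [folklore] -/
theorem norm_conj_inv_add_two_le {g h : Fin 2 × Bool} {ℓ ℓ' : F₂} {A B : List (Fin 2 × Bool)}
    (hA : ℓ.toWord = A ++ [g] ++ invRev A) (hB : ℓ'.toWord = B ++ [h] ++ invRev B)
    (hab : B.length < A.length) (hk : B.length + 1 ≤ maxCancel ℓ.toWord ℓ'.toWord) :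
    (ℓ'⁻¹ * ℓ * ℓ').norm + 2 ≤ ℓ.norm := by
  -- apply (J2) to the pair `(ℓ′⁻¹, ℓ⁻¹)`
  have hA' := toWord_inv_of_toWord hA
  have hB' := toWord_inv_of_toWord hB
  have hk' : B.length + 1 ≤ maxCancel ℓ'⁻¹.toWord ℓ⁻¹.toWord := by
    rwa [FreeGroup.toWord_inv, FreeGroup.toWord_inv, maxCancel_invRev]
  have := norm_conj_add_two_le hB' hA' hab hk'
  rw [FreeGroup.norm_inv_eq] at this
  have e : ℓ'⁻¹ * ℓ⁻¹ * ℓ'⁻¹⁻¹ = (ℓ'⁻¹ * ℓ * ℓ')⁻¹ := by group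
  rwa [e, FreeGroup.norm_inv_eq] at this

/-- **(J4) equal conjugators and deep cancellation force an inverse pair**: if `ℓ = A g A⁻¹`,
`ℓ′ = B h B⁻¹` with `|A| = |B|` and more than `|A|` letters cancel in `ℓ ℓ′`, then `ℓ′ = ℓ⁻¹`.
[folklore] -/
theorem eq_inv_of_maxCancel {g h : Fin 2 × Bool} {ℓ ℓ' : F₂} {A B : List (Fin 2 × Bool)}
    (hA : ℓ.toWord = A ++ [g] ++ invRev A) (hB : ℓ'.toWord = B ++ [h] ++ invRev B)
    (hab : A.length = B.length) (hk : A.length + 1 ≤ maxCancel ℓ.toWord ℓ'.toWord) :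
    ℓ' = ℓ⁻¹ := by
  have htake := take_eq_of_maxCancel_ge hA hk
  have hBh : B ++ [h] = A ++ [(g.1, !g.2)] := by
    rw [← htake, hB, List.take_append_of_le_length (by simp; omega)]
    simp [hab]
  obtain ⟨hBA, hhg⟩ := List.append_inj' hBh rfl
  simp only [List.cons.injEq, and_true] at hhg
  apply FreeGroup.toWord_injective
  rw [toWord_inv_of_toWord hA, hB, hBA, hhg]

/-! ## §3 Three tame junctions keep all cores: the product is not `1` -/

/-- Locality of the maximal cancellation in the left word: if fewer than `|S|` letters of a word
ending in `S` cancel against `Y`, any other word ending in `S` cancels the same number. [folklore] -/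
theorem maxCancel_eq_of_suffix {X X' S Y : List (Fin 2 × Bool)} (hX : ∃ P, X = P ++ S) (hX' : ∃ P', X' = P' ++ S)
    (hlt : maxCancel X Y < S.length) : maxCancel X' Y = maxCancel X Y := by
  obtain ⟨P, rfl⟩ := hX
  obtain ⟨P', rfl⟩ := hX'
  rw [maxCancel, List.reverse_append] at hlt ⊢
  rw [maxCancel, List.reverse_append]
  have h1 : cancelAux S.reverse Y = cancelAux (S.reverse ++ P.reverse) Y := by
    have := cancelAux_take_left_of_lt (S.reverse ++ P.reverse) Y S.length (by simpa using hlt)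
    rw [List.take_append_of_le_length (by simp), List.take_of_length_le (by simp)] at this
    exact this
  have hlt' : cancelAux S.reverse Y < S.reverse.length := by rw [h1]; simpa using hlt
  rw [cancelAux_append_left_of_lt _ _ _ hlt', h1]

/-- **(J1) propagation**: if the reduced word of `x` ends with the second half `g A⁻¹` of the core
letter `ℓ = A g A⁻¹`, and the junction `(ℓ, ℓ′)`, `ℓ′ = B h B⁻¹`, is tame (`k ≤ |A|, |B|` letters
cancel), then the reduced word of `x ℓ′` ends with the second half `h B⁻¹` of `ℓ′`. [folklore] -/
theorem toWord_mul_suffix {g h : Fin 2 × Bool} {x ℓ ℓ' : F₂} {A B : List (Fin 2 × Bool)}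
    (hA : ℓ.toWord = A ++ [g] ++ invRev A) (hB : ℓ'.toWord = B ++ [h] ++ invRev B)
    (hx : ∃ P, x.toWord = P ++ ([g] ++ invRev A))
    (hkA : maxCancel ℓ.toWord ℓ'.toWord ≤ A.length) (hkB : maxCancel ℓ.toWord ℓ'.toWord ≤ B.length) :
    ∃ P', (x * ℓ').toWord = P' ++ ([h] ++ invRev B) := by
  set k := maxCancel ℓ.toWord ℓ'.toWord with hkdef
  have hk' : maxCancel x.toWord ℓ'.toWord = k := by
    apply maxCancel_eq_of_suffix (S := [g] ++ invRev A) ⟨A, by rw [hA, List.append_assoc]⟩ hx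
    rw [← hkdef]; simp [FreeGroup.invRev_length]; omega
  rw [toWord_mul_eq, hk', hB]
  refine ⟨x.toWord.take (x.toWord.length - k) ++ B.drop k, ?_⟩
  rw [List.append_assoc B, List.drop_append_of_le_length hkB, List.append_assoc]

/-- **Three tame junctions keep all four cores**: for core letters `ℓᵢ = Aᵢ gᵢ Aᵢ⁻¹`
(`i = 0,…,3`) such that at each of the three junctions at most `min(|Aᵢ|, |Aᵢ₊₁|)` letters
cancel, the product `ℓ₀ℓ₁ℓ₂ℓ₃` is not `1` (its reduced word still ends with `g₃ A₃⁻¹`).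
(Lyndon–Schupp I §2.) [folklore] -/
theorem prod_ne_one_of_J1 {g₀ g₁ g₂ g₃ : Fin 2 × Bool} {ℓ₀ ℓ₁ ℓ₂ ℓ₃ : F₂}
    {A₀ A₁ A₂ A₃ : List (Fin 2 × Bool)}
    (h₀ : ℓ₀.toWord = A₀ ++ [g₀] ++ invRev A₀) (h₁ : ℓ₁.toWord = A₁ ++ [g₁] ++ invRev A₁)
    (h₂ : ℓ₂.toWord = A₂ ++ [g₂] ++ invRev A₂) (h₃ : ℓ₃.toWord = A₃ ++ [g₃] ++ invRev A₃)
    (k₀A : maxCancel ℓ₀.toWord ℓ₁.toWord ≤ A₀.length) (k₀B : maxCancel ℓ₀.toWord ℓ₁.toWord ≤ A₁.length)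
    (k₁A : maxCancel ℓ₁.toWord ℓ₂.toWord ≤ A₁.length) (k₁B : maxCancel ℓ₁.toWord ℓ₂.toWord ≤ A₂.length)
    (k₂A : maxCancel ℓ₂.toWord ℓ₃.toWord ≤ A₂.length) (k₂B : maxCancel ℓ₂.toWord ℓ₃.toWord ≤ A₃.length) :
    ℓ₀ * ℓ₁ * ℓ₂ * ℓ₃ ≠ 1 := by
  have s₀ : ∃ P, ℓ₀.toWord = P ++ ([g₀] ++ invRev A₀) := ⟨A₀, by rw [h₀, List.append_assoc]⟩
  have s₁ := toWord_mul_suffix h₀ h₁ s₀ k₀A k₀B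
  have s₂ := toWord_mul_suffix h₁ h₂ s₁ k₁A k₁B
  obtain ⟨P, hP⟩ := toWord_mul_suffix h₂ h₃ s₂ k₂A k₂B
  intro h1
  rw [h1, FreeGroup.toWord_one] at hP
  have := congrArg List.length hP
  simp at this

/-- **The four cases at one junction** of core letters `ℓ = A g A⁻¹`, `ℓ′ = B h B⁻¹`: tame (J1),
or the Hurwitz move shortens (J2), or the inverse move shortens (J3), or `ℓ′ = ℓ⁻¹` (J4).
[folklore] -/
theorem junction_cases {g h : Fin 2 × Bool} {ℓ ℓ' : F₂} {A B : List (Fin 2 × Bool)}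
    (hA : ℓ.toWord = A ++ [g] ++ invRev A) (hB : ℓ'.toWord = B ++ [h] ++ invRev B) :
    (maxCancel ℓ.toWord ℓ'.toWord ≤ A.length ∧ maxCancel ℓ.toWord ℓ'.toWord ≤ B.length) ∨
      (ℓ * ℓ' * ℓ⁻¹).norm + 2 ≤ ℓ'.norm ∨ (ℓ'⁻¹ * ℓ * ℓ').norm + 2 ≤ ℓ.norm ∨ ℓ' = ℓ⁻¹ := by
  set k := maxCancel ℓ.toWord ℓ'.toWord with hk
  by_cases h1 : k ≤ A.length ∧ k ≤ B.length
  · exact Or.inl h1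
  rcases lt_trichotomy A.length B.length with hlt | heq | hgt
  · exact Or.inr (Or.inl (norm_conj_add_two_le hA hB hlt (by omega)))
  · exact Or.inr (Or.inr (Or.inr (eq_inv_of_maxCancel hA hB heq (by omega))))
  · exact Or.inr (Or.inr (Or.inl (norm_conj_inv_add_two_le hA hB hgt (by omega))))

end Literature.Topology.FourManifolds.PlanarShadow
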